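import Summits.AtomisticToContinuum.FouriersLaw.Theorems.BondHeatUncertaintySubdiffusiveBondHeatKernelGibbsA
import Literature.MathematicalPhysics.KineticTheory.LangevinChainNESSProofs

/-!
# The transition kernels of the pinned chain in `sdeKernel` form

Helper file for item stmt-AtomisticToContinuum-9144 (`ResponseDensity`, route
`OddSectorIrreversibility`, sub-problem `FouriersLaw` of `AtomisticToContinuum`).

The identification of the model-free transition kernels of `pinnedChain ω₂ lam β γ` with the chain
pipeline's `transitionKernel` is in the tree
(`SubdiffusiveBondHeat.pinnedChain_langevinKernel_eq_transitionKernel`,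
`…Theorems/BondHeatUncertaintySubdiffusiveBondHeatKernelGibbsA.lean`, together with
`SubdiffusiveBondHeat.pinnedChain_isConfining`). This file only records its `sdeKernel` spelling — the
form in which `pairAct` and the backward equation of `ConfinedBackward.lean` /
`LangevinChainReversal.lean` are written — for use by the exact response identity.
-/

noncomputable section

open MeasureTheory ProbabilityTheory
open scoped NNReal

namespace Summit.AtomisticToContinuum.FouriersLaw.Theorems

open Literature.MathematicalPhysics.KineticTheory.HeatConduction
open Literature.MathematicalPhysics.KineticTheory OscillatorChain

/-- The `sdeKernel` spelling of the kernel identification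
`SubdiffusiveBondHeat.pinnedChain_langevinKernel_eq_transitionKernel` (`ω₂ > 0`, `lam, β, γ ≥ 0`):
`sdeKernel Y v_L v_R t = transitionKernel N T_L T_R t` for the drift `Y` and bath directions
`v_L, v_R` of the pinned chain. -/
theorem pinnedChain_sdeKernel_eq_transitionKernel {ω₂ lam β γ : ℝ} (N : ℕ) (T_L T_R : ℝ)
    (hω : 0 < ω₂) (hl : 0 ≤ lam) (hβ : 0 ≤ β) (hγ : 0 ≤ γ) (t : ℝ≥0) :
    sdeKernel ((pinnedChain ω₂ lam β γ).drift N) ((pinnedChain ω₂ lam β γ).bathVecL N T_L)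
        ((pinnedChain ω₂ lam β γ).bathVecR N T_R) t =
      (pinnedChain ω₂ lam β γ).transitionKernel N T_L T_R t :=
  SubdiffusiveBondHeat.pinnedChain_langevinKernel_eq_transitionKernel N T_L T_R hω hl hβ hγ t

end Summit.AtomisticToContinuum.FouriersLaw.Theorems

end
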